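import Summits.BirchSwinnertonDyer.BirchSwinnertonDyer.Theorems.AdditiveBranchIMCTwistFieldDefs
import Literature.NumberTheory.EllipticCurves.BurungaleCastellaSkinner2025.ProductDivisibilitiesIntegralityProofs
import Literature.NumberTheory.EllipticCurves.PAdicBSDSkinnerUrbanProofs
import HarnessLib

/-!
# Crux `GordTwoRankZeroOffCaseOne` (route `AdditiveBranchIMC`, item 19357), lane k1-c2x gen 2: the
# twist-field road in DESCENDED (Burungale–Castella–Skinner (5.3)) shape — the RATIONAL branch
# containment from Kato's rational divisibility (NO image hypothesis), the INTEGRAL one from ONE unit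
# coefficient (Part 1: per datum)

Cell `bsd-addord`, seat `bsd-addord-k1-c2x` (second prover lane on item 19357; director-bsd 2026-08-27:
«uniform IMC-branch divisibility via Skinner–Urban over the quadratic twist field with explicit control
at the additive prime»). HONEST FRAMING: theorems only; the published inputs are DISPLAYED hypotheses in
the exact shape of the tree's named facts (Kato 2004 Thm. 17.4 `kato_divisibility`, clauses (1) torsion and
(2) RATIONAL divisibility ONLY — so NO image hypothesis enters; Rohrlich 1984 `padicLFunction_ne_zero`); the
descended product bound `GordTwistBaseChangeLower{Even,Odd}At W p` (`…TwistFieldDefs`, this lane) is a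
typed CONJECTURE — nothing is asserted about it; the unit coefficient is a displayed per-pair CERTIFICATE
hypothesis; nothing is booked; BSD is not proved by any of this.

## Why a second shape

Gen 0 of this lane typed the road's input INTEGRALLY over the tower datum `X(V/K·ℚ_∞)`, `K = ℚ(√p*)`
(`TwistFieldLowerDivisibility{Even,Odd}At V p`) and reduced items 19497/19498/19357 to it modulo Kato's
divisibility for the good ordinary twist `V` in INTEGRAL form — in print only under a tower-surjective
image (Thm. 17.4 (3)). The (M)-cell of the route (k1-c4, `AdditiveBranchIMCMultLower.MultTwistBaseChangeLowerAt`)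
types ITS base-change input in the descended, K-free, RATIONAL product shape of Burungale–Castella–Skinner
2025 §5 (5.3): `∃ m n G`, `ι G = p^n·𝓛`, `p^m·char X(V/ℚ_∞)·char X(W/ℚ_∞) ⊆ (G)`. This file runs the
(G-ord, `e = 2`) road in THAT shape (`𝓛 = L_p(f,α,T)·ϖ·L_p^{[−]}(f,α,ω^{(p−1)/2},T)`), so that the two cells'
base-change inputs are literally comparable, and — the mathematical point — so that the road reaches the
rows WITHOUT a tower-surjective image: the `p`-power slack is absorbed not by Kato's clause (3) but by ONE
unit coefficient of the Néron-normalised branch `p`-adic `L`-function (`HasUnitContent`, Greenberg–Vatsal's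
reading (2) of `μ = 0`), a finite certificate at the pair.

* §1 `C_pow_dvd_of_mul_eq_mul_of_hasUnitContent` — the slack lemma in `Λ = ℤ_p⟦T⟧`: `p^n·g = h·b`,
  `μ(b) = 0` ⟹ `p^n ∣ h` (Gauss: `Λ/p = 𝔽_p⟦T⟧` is a domain); read in `ℚ_p⟦T⟧`
  (`exists_eq_mul_of_C_pow_mul_eq_of_hasUnitContent`).
* §2 **`exists_C_pow_mul_eq_mul_branch_of_baseChange`** / **`…minusBranch_of_baseChangeOdd`** — per datum:
  (BC-Gord) + Kato (1)(2) RATIONAL for `V` + `L_p(f,α,T) ≠ 0` ⟹ `p^k·ι g ∈ ι(Λ)·(ϖ·L_p^{[−]}(f,α,ω^{(p−1)/2},T))`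
  for every `g ∈ char_Λ X(W/ℚ_∞)` (cancellation of `L_p(f)` in the domain `ℚ_p⟦T⟧`; abstract core
  `exists_C_pow_mul_eq_mul_of_mem_span`).
* §3 **`exists_eq_mul_branch_of_baseChange_of_hasUnitContent`** (+ odd): + ONE unit coefficient ⟹ the
  INTEGRAL conclusion of `ChiBranchLowerDivisibility[Odd]At W p` at the datum.

Sequel (Part 2, `…TwistFieldBaseChangeDoors`): the pair-level currencies `ChiBranchLowerDivisibility[Odd]At W p`
and the rank-`0` doors on cell (G-ord, `e = 2`) at ANY image; gen 0's integral input ⟹ (BC-Gord); the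
rational «no free lunch».

Status in print of (BC-Gord): NONE at an additive pair — Skinner–Urban 2014 Cor. 3.6.3 is this exact
shape with `χ_K` UNRAMIFIED at `p` (Thm. 3.6.1 is proved for the Eisenstein datum `(𝐟, 1, 1, Σ)` only,
§7.4, although (11.9.3.a) admits `ξ` ramified above `p`); Wan 2015: `p` unramified; BCS 2025 Lemma
5.2.3: auxiliary fields with `p` split / inert (read first-hand this session, seat NOTES).

References: K. Kato, Astérisque 295 (2004) Thm. 17.4 [Kato2004Asterisque]; D. Rohrlich, Invent. Math. 75
(1984) [RohrlichInventiones1984]; Burungale–Castella–Skinner, IMRN 2025 §5 (5.3), Lemma 5.2.3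
[BurungaleCastellaSkinner2025]; Skinner–Urban, Invent. Math. 195 (2014) Cor. 3.6.3, §7.4
[SkinnerUrban2014]; Greenberg–Vatsal, Invent. Math. 142 (2000) p. 2 (2) [GreenbergVatsal2000];
Mazur–Tate–Teitelbaum, Invent. Math. 84 (1986) §I.12–I.14 [MazurTateTeitelbaum1986Invent].
-/

set_option autoImplicit false
set_option linter.dupNamespace false

noncomputable section

open scoped Classical MatrixGroups ModularForm

open CongruenceSubgroup WeierstrassCurve Literature.NumberTheory.EllipticCurves
  Literature.NumberTheory.EllipticCurves.ModularForms
  Literature.NumberTheory.EllipticCurves.Rank1Residual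
  Literature.NumberTheory.GaloisRepresentations
  Literature.NumberTheory.EllipticCurves.GreenbergVatsal2000

namespace Summit.BirchSwinnertonDyer.BirchSwinnertonDyer.Theorems.AdditiveBranchIMCTwistField

/-! ## §1 `Λ`-arithmetic: a `p`-power slack is absorbed by a factor of unit content -/

section Slack

variable {p : ℕ} [hp : Fact p.Prime]

/-- In `Λ = ℤ_p⟦T⟧`: no element of the form `p^{n+1}·g` has unit content. [folklore] -/
theorem not_hasUnitContent_C_pow_succ_mul (n : ℕ) (g : IwasawaAlgebra p) :
    ¬ HasUnitContent (PowerSeries.C ((p : ℤ_[p]) ^ (n + 1)) * g) := by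
  rintro ⟨k, hk⟩
  rw [PowerSeries.coeff_C_mul] at hk
  have hpu : IsUnit (p : ℤ_[p]) :=
    isUnit_of_dvd_unit (dvd_mul_of_dvd_left (dvd_pow_self _ (Nat.succ_ne_zero n)) _) hk
  exact (PadicInt.irreducible_p (p := p)).not_isUnit hpu

/-- **Slack lemma.** In `Λ = ℤ_p⟦T⟧`: if `p^n · g = h · b` and `b` has unit content (`μ(b) = 0`), then
`p^n ∣ h` (the prime `p` of `Λ`: `Λ/p = 𝔽_p⟦T⟧` is a domain — Gauss). [folklore] -/
theorem C_pow_dvd_of_mul_eq_mul_of_hasUnitContent :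
    ∀ (n : ℕ) {g h b : IwasawaAlgebra p}, HasUnitContent b →
      PowerSeries.C ((p : ℤ_[p]) ^ n) * g = h * b → PowerSeries.C ((p : ℤ_[p]) ^ n) ∣ h := by
  intro n
  induction n with
  | zero => intro g h b _ _; exact ⟨h, by simp⟩
  | succ n ih =>
    intro g h b hb he
    -- `h` has no unit content, else `h·b = p^{n+1}·g` would
    have hh : PowerSeries.C (p : ℤ_[p]) ∣ h := by
      by_contra hnd
      have hhu : HasUnitContent h := (hasUnitContent_iff_not_C_dvd h).mpr hnd
      exact not_hasUnitContent_C_pow_succ_mul n g (he ▸ hasUnitContent_mul hhu hb)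
    obtain ⟨h₁, rfl⟩ := hh
    have hC : (PowerSeries.C (p : ℤ_[p])) ≠ 0 :=
      (map_ne_zero_iff _ PowerSeries.C_injective).mpr (by exact_mod_cast hp.out.ne_zero)
    have he' : PowerSeries.C ((p : ℤ_[p]) ^ n) * g = h₁ * b := by
      apply mul_left_cancel₀ hC
      rw [← mul_assoc, ← map_mul, ← pow_succ', he, mul_assoc]
    obtain ⟨h₂, rfl⟩ := ih hb he'
    exact ⟨h₂, by rw [pow_succ', map_mul, mul_assoc]⟩

/-- **Slack lemma, read in `ℚ_p⟦T⟧`.** If `p^n · ι g = ι h · B` with `B = ι b`, `b ∈ Λ` of unit content,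
then `ι g = ι h' · B` for some `h' ∈ Λ`. [folklore] -/
theorem exists_eq_mul_of_C_pow_mul_eq_of_hasUnitContent {n : ℕ} {g h b : IwasawaAlgebra p}
    {B : PowerSeries ℚ_[p]} (hb : HasUnitContent b) (hιb : iwasawaToPowerSeries p b = B)
    (he : PowerSeries.C ((p : ℚ_[p]) ^ n) * iwasawaToPowerSeries p g = iwasawaToPowerSeries p h * B) :
    ∃ h' : IwasawaAlgebra p, iwasawaToPowerSeries p g = iwasawaToPowerSeries p h' * B := by
  have heΛ : PowerSeries.C ((p : ℤ_[p]) ^ n) * g = h * b := by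
    apply iwasawaToPowerSeries_injective p
    rw [map_mul, map_mul, iwasawaToPowerSeries_C_natCast_pow p, he, hιb]
  obtain ⟨h', rfl⟩ := C_pow_dvd_of_mul_eq_mul_of_hasUnitContent n hb heΛ
  have hC : PowerSeries.C ((p : ℤ_[p]) ^ n) ≠ 0 :=
    (map_ne_zero_iff _ PowerSeries.C_injective).mpr (pow_ne_zero _ (by exact_mod_cast hp.out.ne_zero))
  have hg : g = h' * b := mul_left_cancel₀ hC (by rw [heΛ, mul_assoc])
  exact ⟨h', by rw [hg, map_mul, hιb]⟩

end Slack

/-! ## §2 The descended product bound gives the RATIONAL branch containment (Kato (2), Rohrlich) -/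

section Rational

variable {p : ℕ} [hp : Fact p.Prime]

/-- **Abstract core of `⇒`** (any `L`, `B`): if `ι G = p^n · L · B`, `p^m · (x·y) ∈ (G)` for the pair
`(x, y) = (g₀, g)` with `ι g₀ = p^a · L` (Kato's RATIONAL divisibility at `g₀ ∈ char X(V/ℚ_∞)`) and
`L ≠ 0` (Rohrlich), then `p^{m+a} · ι g = ι h · B` for some `h ∈ Λ` — cancellation of `L` in the domain
`ℚ_p⟦T⟧`; no image hypothesis anywhere. [folklore] -/
theorem exists_C_pow_mul_eq_mul_of_mem_span {m n a : ℕ} {G g₀ g : IwasawaAlgebra p}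
    {L B : PowerSeries ℚ_[p]}
    (hG : iwasawaToPowerSeries p G = PowerSeries.C ((p : ℚ_[p]) ^ n) * (L * B))
    (hmem : PowerSeries.C ((p : ℤ_[p]) ^ m) * (g₀ * g) ∈ Ideal.span {G})
    (hg₀ : iwasawaToPowerSeries p g₀ = PowerSeries.C ((p : ℚ_[p]) ^ a) * L) (hL : L ≠ 0) :
    ∃ h : IwasawaAlgebra p,
      PowerSeries.C ((p : ℚ_[p]) ^ (m + a)) * iwasawaToPowerSeries p g =
        iwasawaToPowerSeries p h * B := by
  obtain ⟨r, hr⟩ := Ideal.mem_span_singleton'.mp hmem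
  refine ⟨PowerSeries.C ((p : ℤ_[p]) ^ n) * r, mul_left_cancel₀ hL ?_⟩
  have h := congrArg (iwasawaToPowerSeries p) hr
  rw [map_mul, map_mul, map_mul, iwasawaToPowerSeries_C_natCast_pow p, hG, hg₀] at h
  -- `h : ι r * (p^n (L B)) = p^m * (p^a L * ι g)`
  rw [map_mul, iwasawaToPowerSeries_C_natCast_pow p, pow_add, map_mul]
  linear_combination -h

/-- **`⇒`, EVEN branch, RATIONAL, per datum** (`p ≡ 1 (mod 4)`): from (BC-Gord, even) for `W` — the
descended product bound — together with, DISPLAYED, Kato's divisibility for the good ordinary twist model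
`V` in its RATIONAL form (Thm. 17.4 (1)(2): `X(V/ℚ_∞)` torsion, `∃ a, ∃ g₀ ∈ char`, `ι g₀ = p^a·L_p(f,α,T)`;
NO image hypothesis) and `L_p(f,α,T) ≠ 0` (Rohrlich), every `g ∈ char_Λ X(W/ℚ_∞)` (torsion datum)
satisfies `p^k · ι g ∈ ι(Λ) · (ϖ·L_p(f, α, ω^{(p−1)/2}, T))` for some `k` — the RATIONAL form of the
conclusion of `ChiBranchLowerDivisibilityAt W p` at this datum.
[cite: Kato2004Asterisque, Thm. 17.4 (1)(2) (p. 273)] [cite: RohrlichInventiones1984, Theorem (p. 409)]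
[cite: BurungaleCastellaSkinner2025, §5 (5.3) (shape)] -/
theorem exists_C_pow_mul_eq_mul_branch_of_baseChange {W : WeierstrassCurve ℚ}
    (hBC : GordTwistBaseChangeLowerEvenAt W p)
    (V : WeierstrassCurve ℚ) [V.IsElliptic] [V.IsGloballyMinimal] {C : VariableChange ℚ}
    (hV : GoodOrd V p) (hCW : C • V.quadraticTwist (p : ℚ) = W)
    {N : ℕ} [NeZero N] {f : CuspForm (Gamma0 N) 2} (hf : IsNewformOf V f)
    {κ : ZpExtension ℚ p} {γ : Field.absoluteGaloisGroup ℚ}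
    (hκ : κ.IsCyclotomic) (hγ : κ.IsTopGenerator γ) (hγ' : IsCyclotomicVariable p γ)
    (DV : V.SelmerDualData κ γ) (hVt : DV.IsTorsion)
    (hKV : ∃ (a : ℕ) (g₀ : IwasawaAlgebra p), g₀ ∈ DV.charIdeal ∧
      iwasawaToPowerSeries p g₀ =
        PowerSeries.C ((p : ℚ_[p]) ^ a) * padicLFunction f (unitRoot V p : ℚ_[p]))
    (hL : padicLFunction f (unitRoot V p : ℚ_[p]) ≠ 0)
    (D : W.SelmerDualData κ γ) (hDt : D.IsTorsion) (ϖ : ℚ)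
    (hϖ : (ϖ : ℝ) * V.realPeriodRat = plusPeriod f) (g : IwasawaAlgebra p) (hg : g ∈ D.charIdeal) :
    ∃ (k : ℕ) (h : IwasawaAlgebra p),
      PowerSeries.C ((p : ℚ_[p]) ^ k) * iwasawaToPowerSeries p g =
        iwasawaToPowerSeries p h *
          (PowerSeries.C ((ϖ : ℚ) : ℚ_[p]) * padicLFunctionBranch f (unitRoot V p : ℚ_[p]) (p / 2)) := by
  obtain ⟨m, n, G, hG, hspan⟩ := hBC V C hV hCW f hf κ γ hκ hγ hγ' DV D ϖ hVt hDt hϖ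
  obtain ⟨a, g₀, hg₀, hιg₀⟩ := hKV
  exact ⟨m + a, exists_C_pow_mul_eq_mul_of_mem_span hG (hspan g₀ hg₀ g hg) hιg₀ hL⟩

/-- **`⇒`, ODD branch, RATIONAL, per datum** (`p ≡ 3 (mod 4)`, `p = 3` included): the odd twin of
`exists_C_pow_mul_eq_mul_branch_of_baseChange` (minus symbols, `ϖ⁻·|Ω⁻(V)| = Ω⁻_f`).
[cite: Kato2004Asterisque, Thm. 17.4 (1)(2) (p. 273)] [cite: RohrlichInventiones1984, Theorem (p. 409)]
[cite: BurungaleCastellaSkinner2025, §5 (5.3) (shape)] -/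
theorem exists_C_pow_mul_eq_mul_minusBranch_of_baseChangeOdd {W : WeierstrassCurve ℚ}
    (hBC : GordTwistBaseChangeLowerOddAt W p)
    (V : WeierstrassCurve ℚ) [V.IsElliptic] [V.IsGloballyMinimal] {C : VariableChange ℚ}
    (hV : GoodOrd V p) (hCW : C • V.quadraticTwist (-(p : ℚ)) = W)
    {N : ℕ} [NeZero N] {f : CuspForm (Gamma0 N) 2} (hf : IsNewformOf V f)
    {κ : ZpExtension ℚ p} {γ : Field.absoluteGaloisGroup ℚ}
    (hκ : κ.IsCyclotomic) (hγ : κ.IsTopGenerator γ) (hγ' : IsCyclotomicVariable p γ)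
    (DV : V.SelmerDualData κ γ) (hVt : DV.IsTorsion)
    (hKV : ∃ (a : ℕ) (g₀ : IwasawaAlgebra p), g₀ ∈ DV.charIdeal ∧
      iwasawaToPowerSeries p g₀ =
        PowerSeries.C ((p : ℚ_[p]) ^ a) * padicLFunction f (unitRoot V p : ℚ_[p]))
    (hL : padicLFunction f (unitRoot V p : ℚ_[p]) ≠ 0)
    (D : W.SelmerDualData κ γ) (hDt : D.IsTorsion) (ϖ : ℚ)
    (hϖ : (ϖ : ℝ) * V.imaginaryPeriodRat = minusPeriod f) (g : IwasawaAlgebra p)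
    (hg : g ∈ D.charIdeal) :
    ∃ (k : ℕ) (h : IwasawaAlgebra p),
      PowerSeries.C ((p : ℚ_[p]) ^ k) * iwasawaToPowerSeries p g =
        iwasawaToPowerSeries p h *
          (PowerSeries.C ((ϖ : ℚ) : ℚ_[p]) *
            padicLFunctionMinusBranch f (unitRoot V p : ℚ_[p]) (p / 2)) := by
  obtain ⟨m, n, G, hG, hspan⟩ := hBC V C hV hCW f hf κ γ hκ hγ hγ' DV D ϖ hVt hDt hϖ
  obtain ⟨a, g₀, hg₀, hιg₀⟩ := hKV
  exact ⟨m + a, exists_C_pow_mul_eq_mul_of_mem_span hG (hspan g₀ hg₀ g hg) hιg₀ hL⟩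

end Rational

/-! ## §3 The INTEGRAL branch containment from ONE unit coefficient (a finite certificate) -/

section Integral

variable {p : ℕ} [hp : Fact p.Prime]

/-- **`⇒`, EVEN branch, INTEGRAL, per datum, modulo a `μ`-certificate.** In the setting of
`exists_C_pow_mul_eq_mul_branch_of_baseChange`, if moreover the Néron-normalised branch function
`ϖ·L_p(f, α, ω^{(p−1)/2}, T)` is `ι b` for some `b ∈ Λ` with a UNIT COEFFICIENT (`HasUnitContent b`, i.e.
`μ(b) = 0`; certified at a pair by exhibiting one coefficient of `p`-adic norm `1`), then every
`g ∈ char_Λ X(W/ℚ_∞)` is a `Λ`-multiple of `ϖ·L_p(f, α, ω^{(p−1)/2}, T)` — the conclusion of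
`ChiBranchLowerDivisibilityAt W p` at this datum, reached WITHOUT any image hypothesis (slack lemma §1).
[cite: Kato2004Asterisque, Thm. 17.4 (1)(2) (p. 273)] [cite: RohrlichInventiones1984, Theorem (p. 409)]
[cite: GreenbergVatsal2000, p. 2, (2) (μ = 0 as "p ∤ f(T)")] -/
theorem exists_eq_mul_branch_of_baseChange_of_hasUnitContent {W : WeierstrassCurve ℚ}
    (hBC : GordTwistBaseChangeLowerEvenAt W p)
    (V : WeierstrassCurve ℚ) [V.IsElliptic] [V.IsGloballyMinimal] {C : VariableChange ℚ}
    (hV : GoodOrd V p) (hCW : C • V.quadraticTwist (p : ℚ) = W)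
    {N : ℕ} [NeZero N] {f : CuspForm (Gamma0 N) 2} (hf : IsNewformOf V f)
    {κ : ZpExtension ℚ p} {γ : Field.absoluteGaloisGroup ℚ}
    (hκ : κ.IsCyclotomic) (hγ : κ.IsTopGenerator γ) (hγ' : IsCyclotomicVariable p γ)
    (DV : V.SelmerDualData κ γ) (hVt : DV.IsTorsion)
    (hKV : ∃ (a : ℕ) (g₀ : IwasawaAlgebra p), g₀ ∈ DV.charIdeal ∧
      iwasawaToPowerSeries p g₀ =
        PowerSeries.C ((p : ℚ_[p]) ^ a) * padicLFunction f (unitRoot V p : ℚ_[p]))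
    (hL : padicLFunction f (unitRoot V p : ℚ_[p]) ≠ 0)
    (D : W.SelmerDualData κ γ) (hDt : D.IsTorsion) (ϖ : ℚ)
    (hϖ : (ϖ : ℝ) * V.realPeriodRat = plusPeriod f)
    (hU : ∃ b : IwasawaAlgebra p, iwasawaToPowerSeries p b =
      PowerSeries.C ((ϖ : ℚ) : ℚ_[p]) * padicLFunctionBranch f (unitRoot V p : ℚ_[p]) (p / 2) ∧
      HasUnitContent b)
    (g : IwasawaAlgebra p) (hg : g ∈ D.charIdeal) :
    ∃ h : IwasawaAlgebra p,
      iwasawaToPowerSeries p g =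
        iwasawaToPowerSeries p h *
          (PowerSeries.C ((ϖ : ℚ) : ℚ_[p]) * padicLFunctionBranch f (unitRoot V p : ℚ_[p]) (p / 2)) := by
  obtain ⟨k, h, hk⟩ := exists_C_pow_mul_eq_mul_branch_of_baseChange hBC V hV hCW hf hκ hγ hγ' DV hVt
    hKV hL D hDt ϖ hϖ g hg
  obtain ⟨b, hb, hbu⟩ := hU
  exact exists_eq_mul_of_C_pow_mul_eq_of_hasUnitContent hbu hb hk

/-- **`⇒`, ODD branch, INTEGRAL, per datum, modulo a `μ`-certificate** (`p ≡ 3 (mod 4)`, `p = 3` included):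
the odd twin of `exists_eq_mul_branch_of_baseChange_of_hasUnitContent` — the conclusion of
`ChiBranchLowerDivisibilityOddAt W p` at the datum from (BC-Gord, odd), Kato (1)(2) rational, Rohrlich,
and ONE unit coefficient of `ϖ⁻·L_p⁻(f, α, ω^{(p−1)/2}, T)`.
[cite: Kato2004Asterisque, Thm. 17.4 (1)(2) (p. 273)] [cite: RohrlichInventiones1984, Theorem (p. 409)]
[cite: GreenbergVatsal2000, p. 2, (2)] -/
theorem exists_eq_mul_minusBranch_of_baseChangeOdd_of_hasUnitContent {W : WeierstrassCurve ℚ}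
    (hBC : GordTwistBaseChangeLowerOddAt W p)
    (V : WeierstrassCurve ℚ) [V.IsElliptic] [V.IsGloballyMinimal] {C : VariableChange ℚ}
    (hV : GoodOrd V p) (hCW : C • V.quadraticTwist (-(p : ℚ)) = W)
    {N : ℕ} [NeZero N] {f : CuspForm (Gamma0 N) 2} (hf : IsNewformOf V f)
    {κ : ZpExtension ℚ p} {γ : Field.absoluteGaloisGroup ℚ}
    (hκ : κ.IsCyclotomic) (hγ : κ.IsTopGenerator γ) (hγ' : IsCyclotomicVariable p γ)
    (DV : V.SelmerDualData κ γ) (hVt : DV.IsTorsion)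
    (hKV : ∃ (a : ℕ) (g₀ : IwasawaAlgebra p), g₀ ∈ DV.charIdeal ∧
      iwasawaToPowerSeries p g₀ =
        PowerSeries.C ((p : ℚ_[p]) ^ a) * padicLFunction f (unitRoot V p : ℚ_[p]))
    (hL : padicLFunction f (unitRoot V p : ℚ_[p]) ≠ 0)
    (D : W.SelmerDualData κ γ) (hDt : D.IsTorsion) (ϖ : ℚ)
    (hϖ : (ϖ : ℝ) * V.imaginaryPeriodRat = minusPeriod f)
    (hU : ∃ b : IwasawaAlgebra p, iwasawaToPowerSeries p b =
      PowerSeries.C ((ϖ : ℚ) : ℚ_[p]) * padicLFunctionMinusBranch f (unitRoot V p : ℚ_[p]) (p / 2) ∧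
      HasUnitContent b)
    (g : IwasawaAlgebra p) (hg : g ∈ D.charIdeal) :
    ∃ h : IwasawaAlgebra p,
      iwasawaToPowerSeries p g =
        iwasawaToPowerSeries p h *
          (PowerSeries.C ((ϖ : ℚ) : ℚ_[p]) *
            padicLFunctionMinusBranch f (unitRoot V p : ℚ_[p]) (p / 2)) := by
  obtain ⟨k, h, hk⟩ := exists_C_pow_mul_eq_mul_minusBranch_of_baseChangeOdd hBC V hV hCW hf hκ hγ hγ'
    DV hVt hKV hL D hDt ϖ hϖ g hg
  obtain ⟨b, hb, hbu⟩ := hU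
  exact exists_eq_mul_of_C_pow_mul_eq_of_hasUnitContent hbu hb hk

end Integral

end Summit.BirchSwinnertonDyer.BirchSwinnertonDyer.Theorems.AdditiveBranchIMCTwistField

end
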